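import Literature.NumberTheory.LFunctions.Zhang2022.MainTermFormFrequencies

/-!
# The one-parameter deformation `F_ℓ` of the main-term form `𝔅` and its knife edge at `ℓ = 1`

Companion to `MainTermFormPSD` (the glued main-term Hermitian form `𝔅 = mainTermForm` of the Zhang (2022)
repair cell, proved positive semidefinite there) and `MainTermFormFrequencies` (the values
`𝔅(e^{−iπjy}) = 8π(j−1)(j−2)(j−3)/j`). The repair cell's PROOF-O15 certificate (pub-zhang, O15-CERT §5)
introduces the one-parameter family obtained from the closed formula `mainTermForm_eq` by the scaling
`π ↦ πℓ` followed by multiplication by `ℓ`: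

  `F_ℓ(g) = (8/π)‖g′‖² + ℓ[48 Im⟨g′,g⟩ + 16 Im(a₀ā₁)] + ℓ²[88π‖g‖² − 24π Re(Ī(a₀+a₁))] + 48π²ℓ³ Im⟨g, Sg⟩`,

(`S g(x) = ∫₀ˣ g`, `I = S g(1)`, `a₀ = g(0)`, `a₁ = g(1)`), so that `F₁ = 𝔅` (`mainTermFormEll_one`); by the
scaling `y ↦ ℓy`, `F_ℓ` is `ℓ` times the form (4.1) on profiles of total length `ℓ` (O15-CERT §5: «zero spacing `ℓα`
at fixed mollifier length»; the parameter of the repair rung's lever L11 / census row V13).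

Here `F_ℓ` is EVALUATED on the pure frequencies `k_j(y) = e^{−iπjy}` of `MainTermFormFrequencies`:

  `F_ℓ(k_j) = 8π (j−ℓ)(j−2ℓ)(j−3ℓ) / j`          (`mainTermFormEll_afeDir`),

which at `ℓ = 1` is `mainTermForm_afeDir`. Consequences (the «knife edge»): on the first
approximate-functional-equation direction `F_ℓ(e^{−iπy}) = −8π(ℓ−1)(2ℓ−1)(3ℓ−1)`, which is NEGATIVE for
every `ℓ > 1` (`mainTermFormEll_neg_of_one_lt`) — although at `ℓ = 1` the form is `𝔅 ≥ 0` on all of `C¹[0,1]`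
(`mainTermForm_nonneg`) with `k₁, k₂, k₃` as null vectors; likewise `F_ℓ(k₁) < 0` for `1/3 < ℓ < 1/2` and
`F_ℓ(k₂) < 0` for `2/3 < ℓ < 1` (`mainTermFormEll_afeDir_two_neg`). So positivity of the main-term form is not an
open condition in `ℓ`: it fails on an explicit `C¹` profile for every `ℓ > 1` (O15-CERT §5 certified this at eleven
rational `ℓ` with polynomial witnesses; the closed form makes it a one-line statement for all `ℓ > 1`).

All statements cite the manuscript's scale (2.10) (`α = π/log P`, average gap `≃ 2π/log(Dp²t₀²) = α(1+O(α𝓛))`,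
p.4) whose deformation `α ↦ ℓα` the family `F_ℓ` encodes, and (2.13) (the shifts `β_j`, i.e. the directions
`e^{−iπjy}`); the mathematics is elementary calculus (the same four integrals as in `mainTermForm_afeDir`);
the OBJECT `F_ℓ` and its role are the repair cell's
(`run/shared/lean/pub/pub-zhang/b2b-zhang-2/g3/O15-CERT.md` §5; F-S1R repair rung LEVERS.md L11, REPAIR-CENSUS V13).
STATUS OF THE OBJECT (repair-rung lead's condition, stated not hidden): for `ℓ ≠ 1`, `F_ℓ` is the CONTINUED
main-term calculus — the closed formula of `𝔅` with the zero-spacing scale deformed (`α ↦ ℓα` at fixed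
logarithmic lengths, `ℓ` = spacing scale / mollifier scale `log P`) — and NOT the main term of any mean value the
manuscript computes: in arXiv:2211.02515 the scale is pinned, `α := π/log P` with `log P = 𝓛⁹ ≫ log(Dt₀²)`, so
`ℓ ≡ 1 + O(𝓛⁻⁸)` structurally (census row V13: «α pinned by (2.10)»; a regime with `ℓ ≠ 1`, e.g. `P = D^A`,
is outside the manuscript and outside the admissible class of the repair rung). The theorems below therefore say
only this: the positivity that the method enjoys at `ℓ = 1` is lost on an explicit profile for every `ℓ > 1`.
This file makes NO claim about Theorems 1–2 of arXiv:2211.02515 and none about Landau–Siegel zeros.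
-/

noncomputable section

open MeasureTheory Set intervalIntegral
open scoped Real ComplexConjugate
open Literature.Analysis.Fourier

namespace Literature.NumberTheory.LFunctions.Zhang2022

/-- The one-parameter deformation `F_ℓ(g) = ℓ·[𝔅 with π ↦ πℓ](g)` of the main-term form, written out on the
closed formula of `mainTermForm_eq` with the weights `1, ℓ, ℓ², ℓ³` on its four homogeneity classes
(O15-CERT §5 of the repair cell). [cite: Zhang2022LandauSiegel, §2 (2.10) p.4 (zero spacing α = π/log P, gap ≃ 2π/log(Dp²t₀²)), (2.13)] -/
def mainTermFormEll (ℓ : ℝ) (g g' : ℝ → ℂ) : ℝ :=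
    8 / π * (∫ x in (0:ℝ)..1, ‖g' x‖ ^ 2)
    + ℓ * (48 * (∫ x in (0:ℝ)..1, g' x * conj (g x)).im + 16 * (g 0 * conj (g 1)).im)
    + ℓ ^ 2 * (88 * π * (∫ x in (0:ℝ)..1, ‖g x‖ ^ 2)
        - 24 * π * (conj (∫ t in (0:ℝ)..1, g t) * (g 0 + g 1)).re)
    + ℓ ^ 3 * (48 * π ^ 2 * (∫ x in (0:ℝ)..1, g x * conj (∫ t in (0:ℝ)..x, g t)).im)

/-- `F₁ = 𝔅`: at `ℓ = 1` the deformation is the main-term form itself. [cite: Zhang2022LandauSiegel, §2 (2.10) p.4 (zero spacing α = π/log P, gap ≃ 2π/log(Dp²t₀²)), (2.13)] -/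
theorem mainTermFormEll_one (g g' : ℝ → ℂ) : mainTermFormEll 1 g g' = mainTermForm g g' := by
  rw [mainTermForm_eq, mainTermFormEll]
  ring

/-- **`F_ℓ` on pure frequencies**: for `j ≥ 1`, `F_ℓ(e^{−iπjy}) = 8π(j−ℓ)(j−2ℓ)(j−3ℓ)/j` — the four
integrals are those of `mainTermForm_afeDir` (`‖k_j′‖² = π²j²`, `Im⟨k_j′,k_j⟩ = −πj`, `‖k_j‖² = 1`,
`Im⟨k_j,S⟩ = −1/(πj)`, vanishing boundary terms), now weighted `1, ℓ, ℓ², ℓ³`: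
`8πj² − 48πjℓ + 88πℓ² − 48πℓ³/j = (8π/j)(j−ℓ)(j−2ℓ)(j−3ℓ)`. [cite: Zhang2022LandauSiegel, §2 (2.10) p.4 (zero spacing α = π/log P, gap ≃ 2π/log(Dp²t₀²)), (2.13)] -/
theorem mainTermFormEll_afeDir {j : ℕ} (hj : j ≠ 0) (ℓ : ℝ) :
    mainTermFormEll ℓ (afeDir j) (afeDir' j) =
      8 * π * (((j : ℝ) - ℓ) * ((j : ℝ) - 2 * ℓ) * ((j : ℝ) - 3 * ℓ)) / j := by
  have hc := afeFreq_ne_zero hj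
  have hjr : (j : ℝ) ≠ 0 := Nat.cast_ne_zero.mpr hj
  have hπ : π ≠ 0 := Real.pi_ne_zero
  have p1 : ∀ x, ‖afeDir' j x‖ ^ 2 = ((j : ℝ) * π) ^ 2 := by
    intro x; rw [afeDir', norm_mul, norm_afeDir, mul_one, norm_afeFreq]
  have p2 : ∀ x, afeDir' j x * conj (afeDir j x) = afeFreq j := by
    intro x; rw [afeDir', mul_assoc, afeDir_mul_conj, mul_one]
  have p3 : ∀ x, ‖afeDir j x‖ ^ 2 = 1 := by intro x; rw [norm_afeDir, one_pow]
  have p4 : ∀ x, afeDir j x * conj (∫ t in (0:ℝ)..x, afeDir j t) =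
      (afeDir j x - 1) / afeFreq j := by
    intro x
    rw [primitive_afeDir hj, map_div₀, map_sub, map_one, conj_afeFreq]
    have h1 := afeDir_mul_conj j x
    field_simp
    linear_combination (-1 : ℂ) * h1
  have T1 : ∫ x in (0:ℝ)..1, ‖afeDir' j x‖ ^ 2 = ((j : ℝ) * π) ^ 2 := by
    simp only [p1, intervalIntegral.integral_const, sub_zero, smul_eq_mul, one_mul]
  have T2 : ∫ x in (0:ℝ)..1, afeDir' j x * conj (afeDir j x) = afeFreq j := by
    simp only [p2, intervalIntegral.integral_const, sub_zero, one_smul]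
  have T3 : ∫ x in (0:ℝ)..1, ‖afeDir j x‖ ^ 2 = 1 := by
    simp only [p3, intervalIntegral.integral_const, sub_zero, smul_eq_mul, mul_one]
  have T4 : ∫ x in (0:ℝ)..1, afeDir j x * conj (∫ t in (0:ℝ)..x, afeDir j t) =
      (((-1 : ℂ) ^ j - 1) / afeFreq j - 1) / afeFreq j := by
    simp only [p4]
    rw [intervalIntegral.integral_div,
      intervalIntegral.integral_sub ((continuous_afeDir j).intervalIntegrable 0 1)
        intervalIntegrable_const,
      primitive_afeDir hj 1, afeDir_one, intervalIntegral.integral_const]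
    simp
  rw [mainTermFormEll, T1, T2, T3, T4, primitive_afeDir hj 1, afeDir_zero, afeDir_one]
  rcases Nat.even_or_odd j with he | ho
  · rw [he.neg_one_pow]
    simp only [div_eq_mul_inv, inv_afeFreq hj, map_one, map_zero, sub_self, zero_mul, mul_zero,
      zero_sub, Complex.mul_re, Complex.neg_re, Complex.mul_im, Complex.neg_im, Complex.ofReal_re,
      Complex.ofReal_im, Complex.I_re, Complex.I_im, Complex.one_re, Complex.one_im,
      Complex.zero_re, afeFreq_im]
    field_simp
    ring
  · rw [ho.neg_one_pow]
    simp only [div_eq_mul_inv, inv_afeFreq hj, map_mul, map_sub, map_one, map_neg,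
      Complex.conj_ofReal, Complex.conj_I,
      Complex.add_re, Complex.sub_re, Complex.mul_re, Complex.neg_re, Complex.add_im,
      Complex.sub_im, Complex.mul_im, Complex.neg_im, Complex.ofReal_re, Complex.ofReal_im,
      Complex.I_re, Complex.I_im, Complex.one_re, Complex.one_im, afeFreq_im]
    field_simp
    ring

/-- At `ℓ = 1` the formula specialises to `mainTermForm_afeDir`. [cite: Zhang2022LandauSiegel, §2 (2.10) p.4 (zero spacing α = π/log P, gap ≃ 2π/log(Dp²t₀²)), (2.13)] -/
theorem mainTermFormEll_afeDir_one_eq_mainTermForm (j : ℕ) :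
    mainTermFormEll 1 (afeDir j) (afeDir' j) = mainTermForm (afeDir j) (afeDir' j) :=
  mainTermFormEll_one _ _

/-- The first approximate-functional-equation direction: `F_ℓ(e^{−iπy}) = −8π(ℓ−1)(2ℓ−1)(3ℓ−1)`.
[cite: Zhang2022LandauSiegel, §2 (2.10) p.4 (zero spacing α = π/log P, gap ≃ 2π/log(Dp²t₀²)), (2.13)] -/
theorem mainTermFormEll_afeDir_one (ℓ : ℝ) :
    mainTermFormEll ℓ (afeDir 1) (afeDir' 1) = -(8 * π * ((ℓ - 1) * (2 * ℓ - 1) * (3 * ℓ - 1))) := by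
  rw [mainTermFormEll_afeDir one_ne_zero]
  push_cast
  ring

/-- The second direction: `F_ℓ(e^{−2iπy}) = −8π(ℓ−1)(ℓ−2)(3ℓ−2)`. [cite: Zhang2022LandauSiegel, §2 (2.10) p.4 (zero spacing α = π/log P, gap ≃ 2π/log(Dp²t₀²)), (2.13)] -/
theorem mainTermFormEll_afeDir_two (ℓ : ℝ) :
    mainTermFormEll ℓ (afeDir 2) (afeDir' 2) = -(8 * π * ((ℓ - 1) * (ℓ - 2) * (3 * ℓ - 2))) := by
  rw [mainTermFormEll_afeDir two_ne_zero]
  push_cast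
  field_simp
  ring

/-- The third direction: `F_ℓ(e^{−3iπy}) = −8π(ℓ−1)(ℓ−3)(2ℓ−3)`. [cite: Zhang2022LandauSiegel, §2 (2.10) p.4 (zero spacing α = π/log P, gap ≃ 2π/log(Dp²t₀²)), (2.13)] -/
theorem mainTermFormEll_afeDir_three (ℓ : ℝ) :
    mainTermFormEll ℓ (afeDir 3) (afeDir' 3) = -(8 * π * ((ℓ - 1) * (ℓ - 3) * (2 * ℓ - 3))) := by
  rw [mainTermFormEll_afeDir (by norm_num : (3:ℕ) ≠ 0)]
  push_cast
  field_simp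
  ring

/-- **The knife edge on the side `ℓ > 1`**: for every `ℓ > 1` the deformed main-term form is NEGATIVE on the
`C¹` profile `e^{−iπy}` (whereas `F₁ = 𝔅 ≥ 0` on all `C¹` profiles, `mainTermForm_nonneg`, with `e^{−iπy}` a
null vector, `mainTermForm_afeDir_one`). Rayleigh slope at `ℓ = 1`: `−16π` (since `‖e^{−iπy}‖² = 1`).
This is the one-line form of O15-CERT §5(b) («F_ℓ indefinite at every certified ℓ ≠ 1 nearby»). [cite: Zhang2022LandauSiegel, §2 (2.10) p.4 (zero spacing α = π/log P, gap ≃ 2π/log(Dp²t₀²)), (2.13)] -/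
theorem mainTermFormEll_neg_of_one_lt {ℓ : ℝ} (hℓ : 1 < ℓ) :
    mainTermFormEll ℓ (afeDir 1) (afeDir' 1) < 0 := by
  rw [mainTermFormEll_afeDir_one]
  have h1 : 0 < ℓ - 1 := by linarith
  have h2 : 0 < 2 * ℓ - 1 := by linarith
  have h3 : 0 < 3 * ℓ - 1 := by linarith
  have : 0 < 8 * π * ((ℓ - 1) * (2 * ℓ - 1) * (3 * ℓ - 1)) := by positivity
  linarith

/-- The same witness on the window `1/3 < ℓ < 1/2` below the physical point. [cite: Zhang2022LandauSiegel, §2 (2.10) p.4 (zero spacing α = π/log P, gap ≃ 2π/log(Dp²t₀²)), (2.13)] -/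
theorem mainTermFormEll_afeDir_one_neg_of_lt_half {ℓ : ℝ} (h₁ : 1 / 3 < ℓ) (h₂ : ℓ < 1 / 2) :
    mainTermFormEll ℓ (afeDir 1) (afeDir' 1) < 0 := by
  rw [mainTermFormEll_afeDir_one]
  have a : ℓ - 1 < 0 := by linarith
  have b : 2 * ℓ - 1 < 0 := by linarith
  have c : 0 < 3 * ℓ - 1 := by linarith
  have : 0 < (ℓ - 1) * (2 * ℓ - 1) * (3 * ℓ - 1) := by
    have := mul_pos_of_neg_of_neg a b
    positivity
  have : 0 < 8 * π * ((ℓ - 1) * (2 * ℓ - 1) * (3 * ℓ - 1)) := by positivity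
  linarith

/-- The second direction witnesses indefiniteness on `2/3 < ℓ < 1`:
`F_ℓ(e^{−2iπy}) = −8π(ℓ−1)(ℓ−2)(3ℓ−2) < 0` there. [cite: Zhang2022LandauSiegel, §2 (2.10) p.4 (zero spacing α = π/log P, gap ≃ 2π/log(Dp²t₀²)), (2.13)] -/
theorem mainTermFormEll_afeDir_two_neg {ℓ : ℝ} (h₁ : 2 / 3 < ℓ) (h₂ : ℓ < 1) :
    mainTermFormEll ℓ (afeDir 2) (afeDir' 2) < 0 := by
  rw [mainTermFormEll_afeDir_two]
  have a : ℓ - 1 < 0 := by linarith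
  have b : ℓ - 2 < 0 := by linarith
  have c : 0 < 3 * ℓ - 2 := by linarith
  have : 0 < (ℓ - 1) * (ℓ - 2) * (3 * ℓ - 2) := by
    have := mul_pos_of_neg_of_neg a b
    positivity
  have : 0 < 8 * π * ((ℓ - 1) * (ℓ - 2) * (3 * ℓ - 2)) := by positivity
  linarith

/-- Summary of the knife edge in existential form: for every `ℓ > 1` some `C¹` profile makes `F_ℓ`
negative, while at `ℓ = 1` no `C¹` profile does (`mainTermForm_nonneg`, `mainTermFormEll_one`). [cite: Zhang2022LandauSiegel, §2 (2.10) p.4 (zero spacing α = π/log P, gap ≃ 2π/log(Dp²t₀²)), (2.13)] -/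
theorem mainTermFormEll_not_nonneg_of_one_lt {ℓ : ℝ} (hℓ : 1 < ℓ) :
    ∃ g g' : ℝ → ℂ, IsC1OnUnitInterval g g' ∧ mainTermFormEll ℓ g g' < 0 :=
  ⟨afeDir 1, afeDir' 1, isC1_afeDir 1, mainTermFormEll_neg_of_one_lt hℓ⟩

/-- … whereas at the physical point `ℓ = 1`, `F₁(g) = 𝔅(g) ≥ 0` for every `C¹` profile. [cite: Zhang2022LandauSiegel, §2 (2.10) p.4 (zero spacing α = π/log P, gap ≃ 2π/log(Dp²t₀²)), (2.13)] -/
theorem mainTermFormEll_one_nonneg {g g' : ℝ → ℂ} (hg : IsC1OnUnitInterval g g') :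
    0 ≤ mainTermFormEll 1 g g' := by
  rw [mainTermFormEll_one]; exact mainTermForm_nonneg hg

end Literature.NumberTheory.LFunctions.Zhang2022

end
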